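import Summits.CriticalPhenomena.PercolationContinuityZ3.Theorems.PercNearOneGluingNoHeavyLowerTailSahiTangentPairCriterion
import Summits.CriticalPhenomena.PercolationContinuityZ3.Theorems.PercNearOneGluingNoHeavyLowerTailSahiTangentScalingVertex

/-!
# `NoHeavyLowerTail` (crux stmt-CriticalPhenomena-4575), Sahi programme: **THE COIN EXPANSION WITH TWO LAYER WEIGHTS — CONDITIONING SAHI'S `E_n`
# ON ONE BINARY COORDINATE OF AN ARBITRARY WEIGHT**, and the monotone-correlation criterion in that generality

Support file (Sahi cell, seat `prim-sahi-p1`, generation 51; `--supports stmt-CriticalPhenomena-4575`).  Companion of `…SahiTangentPairExpansion` /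
`…SahiTangentPairCriterion`.  Pure proofs, no definitions, no `sorry`, standard axioms.

THE POINT.  The pair expansion of `…SahiTangentPairExpansion` was stated for the product weight `B_s ⊗ μ` (same `μ` on both layers).  Its proof never
uses that: for ANY two real weights `μ¹, μ⁰` on `α`, any real `s`, and the two-layer weight `ν(1,x) = s·μ¹(x)`, `ν(0,x) = (1−s)·μ⁰(x)` on `Bool × α`
(EVERY weight `ν` on `Bool × α` is of this form, e.g. with `s = ν(top layer)`, `μ^ε = ν(ε,·)/ν(layer ε)` the conditional weights when `0 < s < 1`),
and any pair family `F_l(ε,x) = ε ? g¹_l(x) : g⁰_l(x)` (every family of functions on `Bool × α` is one: its two sections),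
`E_{n+1}^{ν}(F) = Σ_{c} Σ_{χ} ψ_{cT,cF}(s) · Π_{χ(B)} (E^{μ¹}(g¹|_B) − E^{μ⁰}(g⁰|_B)) · Π_{¬χ(B)} E^{μ⁰}(g⁰|_B)`     (`sahiE_coin₂_pair_eq_sum`)
with the SAME nonnegative coefficients `ψ = pairCoeff`.  We DERIVE it from the one-weight theorem by realising the two layers inside one weight on
`Bool × α` (`(b,x) ↦ b ? μ¹(x) : μ⁰(x)`, top-supported copies of `g¹`, bottom-supported copies of `g⁰`) and transporting along equal mixed moments
(`sahiE_congr_of_moments`).  CONSEQUENCES (any weights `μ¹, μ⁰`, `0 ≤ s ≤ 1`): the excess over the chord `s·E^{μ¹}(g¹) + (1−s)·E^{μ⁰}(g⁰)` is the sum of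
the terms on `≥ 2` blocks (`sahiE_coin₂_pair_sub_chord`), hence the CRITERION (`chord_le_sahiE_coin₂_pair`): if every proper sub-family satisfies
`0 ≤ E_m^{μ⁰}(g⁰|_B) ≤ E_m^{μ¹}(g¹|_B)` then `s·E^{μ¹}_{n+1}(g¹) + (1−s)·E^{μ⁰}_{n+1}(g⁰) ≤ E^{ν}_{n+1}(F)`.  READING (conditioning on a coordinate `e` of an
FKG measure `ν` on `{0,1}^{m}`; `μ¹ = ν(·|x_e=1)`, `μ⁰ = ν(·|x_e=0)`, `s = ν(x_e=1)`; `F_l = 1_{A_l}`):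
`E_n^{ν}(A) ≥ s·E_n(A | x_e = 1) + (1−s)·E_n(A | x_e = 0)` whenever the conditional Sahi functionals of the proper sub-families are nonnegative given
`x_e = 0` and do not decrease from `x_e = 0` to `x_e = 1` — an inductive handle on Sahi positivity for FKG measures whose missing input is exactly this
monotonicity (false in general for covariances; any induction must aggregate).  Nothing conjectural is asserted. [this work]
-/

namespace Summit.CriticalPhenomena.PercolationContinuityZ3.Theorems.SahiTangent

open Finset Function Literature.Combinatorics.Sahi2008
open scoped BigOperators

noncomputable section

variable {α : Type*} [Fintype α] {n : ℕ}

/-! ### §1 The two layers inside one weight on `Bool × α` -/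

section Layer

variable (μ₁ μ₀ : α → ℝ) (μβ : Bool × α → ℝ) (hμβ : ∀ v, μβ v = if v.1 then μ₁ v.2 else μ₀ v.2)
include hμβ

/-- Expectation of a top-supported function under the layer weight `μβ(b,x) = b ? μ¹(x) : μ⁰(x)`. [this work] -/
theorem ex_layer_top (h : α → ℝ) : ex μβ (fun z => if z.1 then h z.2 else 0) = ex μ₁ h := by
  simp only [ex, Fintype.sum_prod_type, Fintype.sum_bool, hμβ, if_true, Bool.false_eq_true, if_false, mul_zero,
    Finset.sum_const_zero, add_zero]

/-- Expectation of a bottom-supported function under the layer weight. [this work] -/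
theorem ex_layer_bottom (h : α → ℝ) : ex μβ (fun z => if z.1 then 0 else h z.2) = ex μ₀ h := by
  simp only [ex, Fintype.sum_prod_type, Fintype.sum_bool, hμβ, if_true, Bool.false_eq_true, if_false, mul_zero,
    Finset.sum_const_zero, zero_add]

omit hμβ in
omit [Fintype α] in
/-- A product of bottom-supported slots is the bottom-supported slot of the product (nonempty index set). [this work] -/
theorem prod_bottomOnly {ι : Type*} (S : Finset ι) (hS : S.Nonempty) (g : ι → α → ℝ) :
    ∏ i ∈ S, (fun z : Bool × α => if z.1 then 0 else g i z.2) = fun z : Bool × α => if z.1 then 0 else (∏ i ∈ S, g i) z.2 := by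
  funext z
  rcases z with ⟨b, x⟩
  rw [Finset.prod_apply]
  cases b
  · simp only [Bool.false_eq_true, if_false, Finset.prod_apply]
  · simp only [if_true]
    obtain ⟨i, hi⟩ := hS
    exact Finset.prod_eq_zero hi rfl

/-- Sahi's functional of a top-supported family under the layer weight is that of the family under `μ¹`. [this work] -/
theorem sahiE_layer_top (m : ℕ) (g : Fin m → α → ℝ) :
    sahiE μβ m (fun l (z : Bool × α) => if z.1 then g l z.2 else 0) = sahiE μ₁ m g := by
  refine sahiE_congr_of_moments _ _ m _ _ fun S hS => ?_
  rw [prod_topOnly S hS, ex_layer_top μ₁ μ₀ μβ hμβ]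

/-- … and of a bottom-supported family is that under `μ⁰`. [this work] -/
theorem sahiE_layer_bottom (m : ℕ) (g : Fin m → α → ℝ) :
    sahiE μβ m (fun l (z : Bool × α) => if z.1 then 0 else g l z.2) = sahiE μ₀ m g := by
  refine sahiE_congr_of_moments _ _ m _ _ fun S hS => ?_
  rw [prod_bottomOnly S hS, ex_layer_bottom μ₁ μ₀ μβ hμβ]

omit hμβ in
/-- Expectation of a pair slot under the two-weight coin `ν(1,x) = s·μ¹(x)`, `ν(0,x) = (1−s)·μ⁰(x)`. [this work] -/
theorem ex_coin₂_pair (s : ℝ) (a b : α → ℝ) :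
    ex (fun z : Bool × α => if z.1 then s * μ₁ z.2 else (1 - s) * μ₀ z.2) (fun z => if z.1 then a z.2 else b z.2) =
      s * ex μ₁ a + (1 - s) * ex μ₀ b := by
  simp only [ex, Fintype.sum_prod_type, Fintype.sum_bool, if_true, Bool.false_eq_true, if_false, Finset.mul_sum, ← Finset.sum_add_distrib]
  exact Finset.sum_congr rfl fun x _ => by ring

omit hμβ in
omit [Fintype α] in
/-- Products of the layered pair slots (top-supported top sections, bottom-supported bottom sections). [this work] -/
theorem prod_pairLayer {ι : Type*} (S : Finset ι) (hS : S.Nonempty) (g₁ g₀ : ι → α → ℝ) :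
    ∏ i ∈ S, (fun w : Bool × (Bool × α) => if w.1 then (if w.2.1 then g₁ i w.2.2 else 0) else (if w.2.1 then 0 else g₀ i w.2.2)) =
      fun w : Bool × (Bool × α) => if w.1 then (if w.2.1 then (∏ i ∈ S, g₁ i) w.2.2 else 0)
        else (if w.2.1 then 0 else (∏ i ∈ S, g₀ i) w.2.2) := by
  funext w
  rcases w with ⟨b, ⟨b', x⟩⟩
  rw [Finset.prod_apply]
  obtain ⟨i, hi⟩ := hS
  cases b <;> cases b' <;>
    simp only [Bool.false_eq_true, if_false, if_true, Finset.prod_apply] <;> exact Finset.prod_eq_zero hi rfl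

/-- Expectation of a layered pair slot under the coin over the layer weight: `s·E_{μ¹}(a) + (1−s)·E_{μ⁰}(b)`. [this work] -/
theorem ex_coin_layer_pair (s : ℝ) (a b : α → ℝ) :
    ex (fun w : Bool × (Bool × α) => if w.1 then s * μβ w.2 else (1 - s) * μβ w.2)
        (fun w => if w.1 then (if w.2.1 then a w.2.2 else 0) else (if w.2.1 then 0 else b w.2.2)) =
      s * ex μ₁ a + (1 - s) * ex μ₀ b := by
  simp only [ex, Fintype.sum_prod_type, Fintype.sum_bool, hμβ, if_true, Bool.false_eq_true, if_false, mul_zero, add_zero, zero_add,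
    Finset.mul_sum, ← Finset.sum_add_distrib]
  exact Finset.sum_congr rfl fun x _ => by ring

/-- The two-weight coin family has the moments (hence the functionals) of a one-weight coin family over the layer space. [this work] -/
theorem sahiE_coin₂_eq_coin_layer (s : ℝ) (m : ℕ) (g₁ g₀ : Fin m → α → ℝ) :
    sahiE (fun z : Bool × α => if z.1 then s * μ₁ z.2 else (1 - s) * μ₀ z.2) m
        (fun l (z : Bool × α) => if z.1 then g₁ l z.2 else g₀ l z.2) =
      sahiE (fun w : Bool × (Bool × α) => if w.1 then s * μβ w.2 else (1 - s) * μβ w.2) m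
        (fun l (w : Bool × (Bool × α)) => if w.1 then (if w.2.1 then g₁ l w.2.2 else 0) else (if w.2.1 then 0 else g₀ l w.2.2)) := by
  refine sahiE_congr_of_moments _ _ m _ _ fun S hS => ?_
  rw [prod_pairSlot, ex_coin₂_pair, prod_pairLayer S hS, ex_coin_layer_pair μ₁ μ₀ μβ hμβ]

/-! ### §2 The two-weight coin expansion (layer form) -/

/-- The two-weight expansion, layer weight kept abstract (`μβ` with `hμβ`). [this work] -/
theorem sahiE_coin₂_pair_eq_sum' (s : ℝ) (n : ℕ) (g₁ g₀ : Fin (n + 1) → α → ℝ) :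
    sahiE (fun z : Bool × α => if z.1 then s * μ₁ z.2 else (1 - s) * μ₀ z.2) (n + 1)
        (fun l (z : Bool × α) => if z.1 then g₁ l z.2 else g₀ l z.2) =
      ∑ c : OrderedFinpartition (n + 1), ∑ χ : Fin c.length → Bool,
        pairCoeff s (cT χ) (cF χ) *
          ∏ m : Fin c.length, (if χ m then blockE μ₁ g₁ c m - blockE μ₀ g₀ c m else blockE μ₀ g₀ c m) := by
  refine (sahiE_coin₂_eq_coin_layer μ₁ μ₀ μβ hμβ s (n + 1) g₁ g₀).trans
    ((sahiE_coin_pair_eq_sum μβ s n (fun l (v : Bool × α) => if v.1 then g₁ l v.2 else 0)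
      (fun l (v : Bool × α) => if v.1 then 0 else g₀ l v.2)).trans ?_)
  refine sum_congr rfl fun c _ => sum_congr rfl fun χ _ => ?_
  congr 1
  refine prod_congr rfl fun m _ => ?_
  unfold blockE
  rw [sahiE_layer_top μ₁ μ₀ μβ hμβ (c.partSize m) (fun r => g₁ (c.emb m r)),
    sahiE_layer_bottom μ₁ μ₀ μβ hμβ (c.partSize m) (fun r => g₀ (c.emb m r))]

/-- Excess over the chord, layer weight kept abstract. [this work] -/
theorem sahiE_coin₂_pair_sub_chord' (s : ℝ) (n : ℕ) (g₁ g₀ : Fin (n + 1) → α → ℝ) :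
    sahiE (fun z : Bool × α => if z.1 then s * μ₁ z.2 else (1 - s) * μ₀ z.2) (n + 1)
        (fun l (z : Bool × α) => if z.1 then g₁ l z.2 else g₀ l z.2) -
      (s * sahiE μ₁ (n + 1) g₁ + (1 - s) * sahiE μ₀ (n + 1) g₀) =
      ∑ c : OrderedFinpartition (n + 1), ∑ χ : Fin c.length → Bool,
        if 2 ≤ c.length then pairCoeff s (cT χ) (cF χ) *
          ∏ m : Fin c.length, (if χ m then blockE μ₁ g₁ c m - blockE μ₀ g₀ c m else blockE μ₀ g₀ c m) else 0 := by
  have h := sahiE_coin_pair_sub_chord μβ s n (fun l (v : Bool × α) => if v.1 then g₁ l v.2 else 0)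
    (fun l (v : Bool × α) => if v.1 then 0 else g₀ l v.2)
  rw [sahiE_layer_top μ₁ μ₀ μβ hμβ, sahiE_layer_bottom μ₁ μ₀ μβ hμβ] at h
  rw [sahiE_coin₂_eq_coin_layer μ₁ μ₀ μβ hμβ]
  refine h.trans (sum_congr rfl fun c _ => sum_congr rfl fun χ _ => ?_)
  split_ifs
  · unfold pairTerm cbf blockE
    congr 1
    refine prod_congr rfl fun m _ => ?_
    beta_reduce
    rw [sahiE_layer_top μ₁ μ₀ μβ hμβ (c.partSize m) (fun r => g₁ (c.emb m r)),
      sahiE_layer_bottom μ₁ μ₀ μβ hμβ (c.partSize m) (fun r => g₀ (c.emb m r))]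
  · rfl

/-- The criterion, layer weight kept abstract. [this work] -/
theorem chord_le_sahiE_coin₂_pair' {s : ℝ} (hs0 : 0 ≤ s) (hs1 : s ≤ 1) (g₁ g₀ : Fin (n + 1) → α → ℝ)
    (h0 : ∀ m, m ≤ n → ∀ e : Fin m → Fin (n + 1), StrictMono e → 0 ≤ sahiE μ₀ m (fun j => g₀ (e j)))
    (h01 : ∀ m, m ≤ n → ∀ e : Fin m → Fin (n + 1), StrictMono e →
      sahiE μ₀ m (fun j => g₀ (e j)) ≤ sahiE μ₁ m (fun j => g₁ (e j))) :
    s * sahiE μ₁ (n + 1) g₁ + (1 - s) * sahiE μ₀ (n + 1) g₀ ≤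
      sahiE (fun z : Bool × α => if z.1 then s * μ₁ z.2 else (1 - s) * μ₀ z.2) (n + 1)
        (fun l (z : Bool × α) => if z.1 then g₁ l z.2 else g₀ l z.2) := by
  have h := chord_le_sahiE_coin_pair μβ hs0 hs1 (fun l (v : Bool × α) => if v.1 then g₁ l v.2 else 0)
    (fun l (v : Bool × α) => if v.1 then 0 else g₀ l v.2)
    (fun m hm e he => by rw [sahiE_layer_bottom μ₁ μ₀ μβ hμβ m (fun j => g₀ (e j))]; exact h0 m hm e he)
    (fun m hm e he => by
      rw [sahiE_layer_bottom μ₁ μ₀ μβ hμβ m (fun j => g₀ (e j)), sahiE_layer_top μ₁ μ₀ μβ hμβ m (fun j => g₁ (e j))]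
      exact h01 m hm e he)
  rw [sahiE_layer_top μ₁ μ₀ μβ hμβ, sahiE_layer_bottom μ₁ μ₀ μβ hμβ] at h
  rw [sahiE_coin₂_eq_coin_layer μ₁ μ₀ μβ hμβ]
  exact h

end Layer

/-! ### §3 The theorems (two weights) -/

/-- **THE COIN EXPANSION WITH TWO LAYER WEIGHTS (all orders).**  For any real weights `μ¹, μ⁰`, any real `s`, any `n` and all families `g¹, g⁰`:
`E_{n+1}^{ν}(ε ? g¹ : g⁰) = Σ_c Σ_χ ψ_{cT,cF}(s) · Π_{χ(m)} (E^{μ¹}(g¹|c_m) − E^{μ⁰}(g⁰|c_m)) · Π_{¬χ(m)} E^{μ⁰}(g⁰|c_m)`,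
`ν(1,x) = s·μ¹(x)`, `ν(0,x) = (1−s)·μ⁰(x)`. [this work] -/
theorem sahiE_coin₂_pair_eq_sum (μ₁ μ₀ : α → ℝ) (s : ℝ) (n : ℕ) (g₁ g₀ : Fin (n + 1) → α → ℝ) :
    sahiE (fun z : Bool × α => if z.1 then s * μ₁ z.2 else (1 - s) * μ₀ z.2) (n + 1)
        (fun l (z : Bool × α) => if z.1 then g₁ l z.2 else g₀ l z.2) =
      ∑ c : OrderedFinpartition (n + 1), ∑ χ : Fin c.length → Bool,
        pairCoeff s (cT χ) (cF χ) *
          ∏ m : Fin c.length, (if χ m then blockE μ₁ g₁ c m - blockE μ₀ g₀ c m else blockE μ₀ g₀ c m) :=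
  sahiE_coin₂_pair_eq_sum' μ₁ μ₀ (fun v => if v.1 then μ₁ v.2 else μ₀ v.2) (fun _ => rfl) s n g₁ g₀

/-- **Excess over the chord** (two weights): `E^{ν}_{n+1}(F) − [s·E^{μ¹}_{n+1}(g¹) + (1−s)·E^{μ⁰}_{n+1}(g⁰)]` is the sum of the terms on `≥ 2` blocks.
[this work] -/
theorem sahiE_coin₂_pair_sub_chord (μ₁ μ₀ : α → ℝ) (s : ℝ) (n : ℕ) (g₁ g₀ : Fin (n + 1) → α → ℝ) :
    sahiE (fun z : Bool × α => if z.1 then s * μ₁ z.2 else (1 - s) * μ₀ z.2) (n + 1)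
        (fun l (z : Bool × α) => if z.1 then g₁ l z.2 else g₀ l z.2) -
      (s * sahiE μ₁ (n + 1) g₁ + (1 - s) * sahiE μ₀ (n + 1) g₀) =
      ∑ c : OrderedFinpartition (n + 1), ∑ χ : Fin c.length → Bool,
        if 2 ≤ c.length then pairCoeff s (cT χ) (cF χ) *
          ∏ m : Fin c.length, (if χ m then blockE μ₁ g₁ c m - blockE μ₀ g₀ c m else blockE μ₀ g₀ c m) else 0 :=
  sahiE_coin₂_pair_sub_chord' μ₁ μ₀ (fun v => if v.1 then μ₁ v.2 else μ₀ v.2) (fun _ => rfl) s n g₁ g₀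

/-- **MONOTONE-CORRELATION CRITERION, two weights (every order).**  If every proper sub-family satisfies `0 ≤ E_m^{μ⁰}(g⁰|_B) ≤ E_m^{μ¹}(g¹|_B)` and
`0 ≤ s ≤ 1` then `s·E^{μ¹}_{n+1}(g¹) + (1−s)·E^{μ⁰}_{n+1}(g⁰) ≤ E^{ν}_{n+1}(ε ? g¹ : g⁰)`; reading: `E_n(A) ≥ s·E_n(A | x_e = 1) + (1−s)·E_n(A | x_e = 0)`
for events on a space with a distinguished binary coordinate, under monotone conditional sub-family functionals. [this work] -/
theorem chord_le_sahiE_coin₂_pair (μ₁ μ₀ : α → ℝ) {s : ℝ} (hs0 : 0 ≤ s) (hs1 : s ≤ 1) (g₁ g₀ : Fin (n + 1) → α → ℝ)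
    (h0 : ∀ m, m ≤ n → ∀ e : Fin m → Fin (n + 1), StrictMono e → 0 ≤ sahiE μ₀ m (fun j => g₀ (e j)))
    (h01 : ∀ m, m ≤ n → ∀ e : Fin m → Fin (n + 1), StrictMono e →
      sahiE μ₀ m (fun j => g₀ (e j)) ≤ sahiE μ₁ m (fun j => g₁ (e j))) :
    s * sahiE μ₁ (n + 1) g₁ + (1 - s) * sahiE μ₀ (n + 1) g₀ ≤
      sahiE (fun z : Bool × α => if z.1 then s * μ₁ z.2 else (1 - s) * μ₀ z.2) (n + 1)
        (fun l (z : Bool × α) => if z.1 then g₁ l z.2 else g₀ l z.2) :=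
  chord_le_sahiE_coin₂_pair' μ₁ μ₀ (fun v => if v.1 then μ₁ v.2 else μ₀ v.2) (fun _ => rfl) hs0 hs1 g₁ g₀ h0 h01

/-- **Conjecture-T form, two weights**: with moreover `E^{μ⁰}_{n+1}(g⁰) ≥ 0`, `s·E^{μ¹}_{n+1}(g¹) ≤ E^{ν}_{n+1}(ε ? g¹ : g⁰)`. [this work] -/
theorem mul_sahiE_le_sahiE_coin₂_pair (μ₁ μ₀ : α → ℝ) {s : ℝ} (hs0 : 0 ≤ s) (hs1 : s ≤ 1) (g₁ g₀ : Fin (n + 1) → α → ℝ)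
    (h0 : ∀ m, m ≤ n → ∀ e : Fin m → Fin (n + 1), StrictMono e → 0 ≤ sahiE μ₀ m (fun j => g₀ (e j)))
    (h01 : ∀ m, m ≤ n → ∀ e : Fin m → Fin (n + 1), StrictMono e →
      sahiE μ₀ m (fun j => g₀ (e j)) ≤ sahiE μ₁ m (fun j => g₁ (e j)))
    (hg₀ : 0 ≤ sahiE μ₀ (n + 1) g₀) :
    s * sahiE μ₁ (n + 1) g₁ ≤
      sahiE (fun z : Bool × α => if z.1 then s * μ₁ z.2 else (1 - s) * μ₀ z.2) (n + 1)
        (fun l (z : Bool × α) => if z.1 then g₁ l z.2 else g₀ l z.2) :=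
  le_trans (le_add_of_nonneg_right (mul_nonneg (sub_nonneg.2 hs1) hg₀)) (chord_le_sahiE_coin₂_pair μ₁ μ₀ hs0 hs1 g₁ g₀ h0 h01)

/-- **The same family on both layers** (an event family read through one binary coordinate of an arbitrary weight): if the functionals of the
proper sub-families are nonnegative under `μ⁰` and do not decrease from `μ⁰` to `μ¹`, then
`s·E^{μ¹}_{n+1}(g) + (1−s)·E^{μ⁰}_{n+1}(g) ≤ E^{ν}_{n+1}(g ∘ snd)` — `E_n` is at least the mixture of its conditional versions. [this work] -/
theorem chord_le_sahiE_layers (μ₁ μ₀ : α → ℝ) {s : ℝ} (hs0 : 0 ≤ s) (hs1 : s ≤ 1) (g : Fin (n + 1) → α → ℝ)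
    (h0 : ∀ m, m ≤ n → ∀ e : Fin m → Fin (n + 1), StrictMono e → 0 ≤ sahiE μ₀ m (fun j => g (e j)))
    (h01 : ∀ m, m ≤ n → ∀ e : Fin m → Fin (n + 1), StrictMono e →
      sahiE μ₀ m (fun j => g (e j)) ≤ sahiE μ₁ m (fun j => g (e j))) :
    s * sahiE μ₁ (n + 1) g + (1 - s) * sahiE μ₀ (n + 1) g ≤
      sahiE (fun z : Bool × α => if z.1 then s * μ₁ z.2 else (1 - s) * μ₀ z.2) (n + 1) (fun l (z : Bool × α) => g l z.2) := by
  have h := chord_le_sahiE_coin₂_pair μ₁ μ₀ hs0 hs1 g g h0 h01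
  have e : (fun l (z : Bool × α) => if z.1 then g l z.2 else g l z.2) = fun l (z : Bool × α) => g l z.2 := by
    funext l z; split_ifs <;> rfl
  rwa [e] at h

end

end Summit.CriticalPhenomena.PercolationContinuityZ3.Theorems.SahiTangent
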